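import Mathlib
import Summits.NavierStokesRegularity.NavierStokesRegularity.Theorems.EulerZoomLiouvillePowerGaugeEulerLiouvilleSelfSimilarLEI
import Summits.NavierStokesRegularity.NavierStokesRegularity.Theorems.EulerZoomLiouvillePowerGaugeEulerLiouvilleBackwardVanishing
import Summits.NavierStokesRegularity.NavierStokesRegularity.Theorems.EulerZoomLiouvillePowerGaugeEulerLiouvilleSelfSimilarOutgoingProfile
import HarnessLib

/-!
# No Euler collapse with OUTWARD Bernoulli flux near the blow-up point — every member, every `ρ > 0`
# (crux `EulerZoomLiouville.PowerGaugeEulerLiouville` = stmt-NavierStokesRegularity-19832)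

Route №10 `EulerZoomLiouville` (NavierStokesRegularity).  Seat ns-typeII-p2 g3 (cell ns-regularity-ideate
§B).  The physical-variables companion of `…SelfSimilarOutgoing.lean` (which treats exactly self-similar
members): here the member is ARBITRARY.

Let `(u, p, H)` satisfy the three hypotheses of the crux at some exponent `ρ > 0` (suitable weak ancient
Euler pair on the slab `(−∞,0) × ℝ³`, weak gradient, power gauge at the origin for all `a > 0`).  Fix a
radial cutoff `σ` (`= 1` on `B̄_{r}`, `= 0` off `B_{2r}`, inward gradient `∇σ(x) = −k(x) x`, `k ≥ 0`;
`exists_radialCutoff_radius`).  The class' two-time local energy inequality (`ae_energy_le_add_flux`,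
`ν = 0`) says that the local energy `Φ(τ) = ∫ |u(τ,x)|² σ(x) dx` can only grow through the flux
`∫∫ (|u|² + 2p) ⟪u, ∇σ⟫ = −∫∫ k · (|u|² + 2p) ⟪u, x⟫`, i.e. through INWARD Bernoulli flux
`(|u|²/2 + p)⟪u, x⟫ < 0` on the support of `∇σ`; and STUB 2 of the line (`Backward.vanishesBackward_of_gauge`)
says `Φ ≤ ε` at positive-measure sets of arbitrarily remote past times.  Hence:

* `exists_radialCutoff_radius` — the radial cutoff of `…SelfSimilarOutgoingProfile` at any radius `r > 0`.
* `ae_eq_zero_near_origin_of_outgoingFlux` — **every `ρ > 0`, every member**: if the Bernoulli flux is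
  OUTWARD a.e. on `(−∞,0) × B_{r₀}`, `0 ≤ (|u|² + 2p) ⟪u, x⟫`, then `u = 0` a.e. on `(−∞,0) × B_{r₀/3}`.
  Contrapositive portrait: a nontrivial member of Seregin's power-gauged ancient Euler class transports
  Bernoulli energy INWARD on a positive-measure part of `(−∞,0) × B_{r₀}` for EVERY `r₀ > 0` — a collapse
  must be fed through every small sphere around the blow-up point.
* `powerGaugeEulerLiouville_of_outgoingFlux` — the crux VERBATIM plus one hypothesis (outward Bernoulli
  flux a.e. on the slab), every `ρ > 0`: such members vanish.

Complements the lead's threshold-free strata (energy at `t = −∞`) by a hypothesis on the DIRECTION of the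
local energy transport; LEI + stub 2 only (cf. critic-2's K3 notice: LEI-only arguments cannot close the
core).  WHAT THIS IS NOT: not NS, not E — a kernel-checked stratum `--supports` stmt-19832. [folklore]
-/

noncomputable section

-- flat `Theorems/<Route><Decl>…` files of one crux share the namespace of the crux (tree convention)
set_option linter.dupNamespace false

open MeasureTheory Set Filter Topology Metric Function
open scoped ENNReal NNReal InnerProductSpace RealInnerProductSpace Laplacian

namespace Summit.NavierStokesRegularity.NavierStokesRegularity.Theorems.PowerGaugeEulerLiouville

open Literature.Analysis Literature.Analysis.FunctionSpaces Literature.Analysis.FluidPDE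

section Cutoff

/-- **Radial cutoff at radius `r > 0` with inward gradient**: `σ` smooth, compactly supported,
`0 ≤ σ ≤ 1`, `σ = 1` on `B̄_r`, `σ = 0` off `B_{2r}`, `⟪w, ∇σ(z)⟫ = −k(z)⟪w, z⟫` with `k ≥ 0`
(`σ(z) = σ₁(z/r)` with `σ₁` from `exists_radialCutoff`). [folklore] -/
theorem exists_radialCutoff_radius {r : ℝ} (hr : 0 < r) :
    ∃ σ : EuclideanSpace ℝ (Fin 3) → ℝ, ContDiff ℝ (⊤ : ℕ∞) σ ∧ HasCompactSupport σ ∧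
      (∀ z, 0 ≤ σ z) ∧ (∀ z, σ z ≤ 1) ∧ (∀ z, ‖z‖ ≤ r → σ z = 1) ∧ (∀ z, 2 * r ≤ ‖z‖ → σ z = 0) ∧
      ∃ k : EuclideanSpace ℝ (Fin 3) → ℝ, (∀ z, 0 ≤ k z) ∧
        ∀ z w : EuclideanSpace ℝ (Fin 3), ⟪w, gradient σ z⟫ = -(k z * ⟪w, z⟫) := by
  obtain ⟨σ₁, hσ₁, hσ₁c, h0, h1, hone, hzero, k₁, hk₁, hgrad⟩ := exists_radialCutoff
  set L : EuclideanSpace ℝ (Fin 3) →L[ℝ] EuclideanSpace ℝ (Fin 3) :=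
    r⁻¹ • ContinuousLinearMap.id ℝ (EuclideanSpace ℝ (Fin 3)) with hL
  have hLz : ∀ z : EuclideanSpace ℝ (Fin 3), L z = r⁻¹ • z := fun z => by simp [hL]
  set σ : EuclideanSpace ℝ (Fin 3) → ℝ := fun z => σ₁ (r⁻¹ • z) with hσdef
  have hσL : σ = σ₁ ∘ L := by funext z; simp [hσdef, hLz]
  have hnorm : ∀ z : EuclideanSpace ℝ (Fin 3), ‖r⁻¹ • z‖ = r⁻¹ * ‖z‖ := fun z => by
    rw [norm_smul, Real.norm_of_nonneg (inv_nonneg.2 hr.le)]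
  refine ⟨σ, ?_, ?_, fun z => h0 _, fun z => h1 _, fun z hz => ?_, fun z hz => ?_, ?_⟩
  · rw [hσL]; exact hσ₁.comp L.contDiff
  · refine HasCompactSupport.of_support_subset_isCompact
      (isCompact_closedBall (0 : EuclideanSpace ℝ (Fin 3)) (2 * r)) fun z hz => ?_
    rw [mem_closedBall, dist_zero_right]
    by_contra hcon
    refine hz (hzero _ ?_)
    rw [hnorm]
    have : r⁻¹ * (2 * r) = 2 := by field_simp
    calc (2 : ℝ) = r⁻¹ * (2 * r) := this.symm
      _ ≤ r⁻¹ * ‖z‖ := mul_le_mul_of_nonneg_left (not_le.1 hcon).le (inv_nonneg.2 hr.le)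
  · refine hone _ ?_
    rw [hnorm]
    calc r⁻¹ * ‖z‖ ≤ r⁻¹ * r := mul_le_mul_of_nonneg_left hz (inv_nonneg.2 hr.le)
      _ = 1 := inv_mul_cancel₀ hr.ne'
  · exact hzero _ (by
      rw [hnorm]
      have : r⁻¹ * (2 * r) = 2 := by field_simp
      calc (2 : ℝ) = r⁻¹ * (2 * r) := this.symm
        _ ≤ r⁻¹ * ‖z‖ := mul_le_mul_of_nonneg_left hz (inv_nonneg.2 hr.le))
  · refine ⟨fun z => r⁻¹ * (r⁻¹ * k₁ (r⁻¹ • z)), fun z => by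
      have := hk₁ (r⁻¹ • z); positivity, fun z w => ?_⟩
    have hd : HasFDerivAt σ ((fderiv ℝ σ₁ (L z)).comp L) z := by
      rw [hσL]
      exact ((hσ₁.differentiable (by simp)) _).hasFDerivAt.comp z L.hasFDerivAt
    rw [real_inner_comm, _root_.inner_gradient_left, hd.fderiv, ContinuousLinearMap.comp_apply,
      ← _root_.inner_gradient_left, real_inner_comm, hLz, hLz, hgrad, real_inner_smul_left,
      real_inner_smul_right]
    ring

end Cutoff

section Member

variable {ρ : ℝ} {u : ℝ → EuclideanSpace ℝ (Fin 3) → EuclideanSpace ℝ (Fin 3)}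
  {p : ℝ → EuclideanSpace ℝ (Fin 3) → ℝ}
  {H : ℝ → EuclideanSpace ℝ (Fin 3) → EuclideanSpace ℝ (Fin 3) →L[ℝ] EuclideanSpace ℝ (Fin 3)}
  {c : ℝ≥0}

/-- **No Euler collapse with outward Bernoulli flux near the blow-up point (every member, every
`ρ > 0`) — local form.**  Let `(u, p, H)` satisfy the hypotheses of the crux `PowerGaugeEulerLiouville`
at exponent `ρ > 0`.  If `0 ≤ (|u(τ,x)|² + 2p(τ,x)) ⟪u(τ,x), x⟫` for a.e. `(τ, x) ∈ (−∞,0) × B_{r₀}`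
(outward Bernoulli flux), then `u = 0` a.e. on `(−∞,0) × B_{r₀/3}`.  Mechanism: for the radial cutoff
`σ` at radius `r₀/3` (supported in `B_{2r₀/3} ⊂ B_{r₀}`) the flux term of the two-time local energy
inequality is `≤ 0`, so `Φ(τ) = ∫ |u(τ)|² σ` is a.e. non-increasing in `τ`; stub 2
(`Backward.vanishesBackward_of_gauge`) makes `Φ ≤ ε` frequently in every far past; hence `Φ = 0` for
a.e. `τ < 0`. [folklore] -/
theorem ae_eq_zero_near_origin_of_outgoingFlux (hρ : 0 < ρ)
    (hsw : IsSuitableWeakSolutionOn (slab (EuclideanSpace ℝ (Fin 3)) (Iio 0) isOpen_Iio) 0 0 u p)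
    (hH : HasWeakSpatialGradientOn (slab (EuclideanSpace ℝ (Fin 3)) (Iio 0) isOpen_Iio) u H)
    (hgauge : ∀ a : ℝ, 0 < a →
      ENNReal.ofReal (a ^ (2 * ρ)) * cknA a (0 : ℝ × EuclideanSpace ℝ (Fin 3)) u +
          ENNReal.ofReal (a ^ ρ) * cknE a (0 : ℝ × EuclideanSpace ℝ (Fin 3)) H +
        ENNReal.ofReal (a ^ (2 * ρ)) * cknD a (0 : ℝ × EuclideanSpace ℝ (Fin 3)) p ≤ (c : ℝ≥0∞))
    {r₀ : ℝ} (hr₀ : 0 < r₀)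
    (hout : ∀ᵐ z ∂(volume.restrict (Iio (0 : ℝ) ×ˢ (univ : Set (EuclideanSpace ℝ (Fin 3))))),
      ‖z.2‖ < r₀ → 0 ≤ (‖u z.1 z.2‖ ^ 2 + 2 * p z.1 z.2) * ⟪u z.1 z.2, z.2⟫) :
    ∀ᵐ z ∂(volume.restrict (Iio (0 : ℝ) ×ˢ (univ : Set (EuclideanSpace ℝ (Fin 3))))),
      ‖z.2‖ < r₀ / 3 → u z.1 z.2 = 0 := by
  have hA : ∀ a : ℝ, 0 < a → ENNReal.ofReal (a ^ (2 * ρ)) *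
      cknA a (0 : ℝ × EuclideanSpace ℝ (Fin 3)) u ≤ (c : ℝ≥0∞) :=
    fun a ha => le_trans (le_trans le_self_add le_self_add) (hgauge a ha)
  have hE : ∀ a : ℝ, 0 < a → ENNReal.ofReal (a ^ ρ) *
      cknE a (0 : ℝ × EuclideanSpace ℝ (Fin 3)) H ≤ (c : ℝ≥0∞) :=
    fun a ha => le_trans (le_trans le_add_self le_self_add) (hgauge a ha)
  -- the cutoff at radius `r = r₀/3`: support in `B̄_{2r₀/3} ⊂ B_{r₀}`
  have hr : 0 < r₀ / 3 := by positivity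
  obtain ⟨σ, hσ, hσcs, hσ0, hσle, hσ1, hσzero, k, hk, hσk⟩ := exists_radialCutoff_radius hr
  have hgrad0 : ∀ x : EuclideanSpace ℝ (Fin 3), 2 * (r₀ / 3) < ‖x‖ → gradient σ x = 0 := by
    intro x hx
    refine gradient_eq_zero_of_eventuallyEq_const (c := 0) ?_
    have ho : IsOpen {y : EuclideanSpace ℝ (Fin 3) | 2 * (r₀ / 3) < ‖y‖} :=
      isOpen_lt continuous_const continuous_norm
    exact eventuallyEq_of_mem (ho.mem_nhds hx) fun y hy => hσzero y (le_of_lt hy)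
  -- notation: the local energy against `σ`
  set Φ : ℝ → ℝ := fun τ => ∫ x, ‖u τ x‖ ^ 2 * σ x with hΦ
  have hΦ0 : ∀ τ, 0 ≤ Φ τ := fun τ => integral_nonneg fun x => mul_nonneg (sq_nonneg _) (hσ0 _)
  -- (1) the flux integrand is `≤ 0` a.e. on the slab
  have hSm : MeasurableSet (Iio (0 : ℝ) ×ˢ (univ : Set (EuclideanSpace ℝ (Fin 3)))) :=
    measurableSet_Iio.prod MeasurableSet.univ
  have hflux0 : ∀ᵐ z ∂(volume : Measure (ℝ × EuclideanSpace ℝ (Fin 3))),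
      z ∈ Iio (0 : ℝ) ×ˢ (univ : Set (EuclideanSpace ℝ (Fin 3))) →
        ‖u z.1 z.2‖ ^ 2 * (0 * (Δ σ) z.2) +
          (‖u z.1 z.2‖ ^ 2 + 2 * p z.1 z.2) * ⟪u z.1 z.2, gradient σ z.2⟫ ≤ 0 := by
    have h := (ae_restrict_iff' hSm).1 hout
    filter_upwards [h] with z hz hzS
    rw [zero_mul, mul_zero, zero_add]
    by_cases hzr : ‖z.2‖ < r₀
    · have h0 := hz hzS hzr
      rw [hσk]
      have e : (‖u z.1 z.2‖ ^ 2 + 2 * p z.1 z.2) * -(k z.2 * ⟪u z.1 z.2, z.2⟫) =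
          -(k z.2 * ((‖u z.1 z.2‖ ^ 2 + 2 * p z.1 z.2) * ⟪u z.1 z.2, z.2⟫)) := by ring
      rw [e, neg_nonpos]
      exact mul_nonneg (hk _) h0
    · rw [not_lt] at hzr
      rw [hgrad0 z.2 (by linarith), inner_zero_right, mul_zero]
  -- (2) a.e. monotonicity of `Φ`
  have hmono : ∀ᵐ τ₁ : ℝ, τ₁ < 0 → ∀ᵐ τ₂ : ℝ, τ₂ ∈ Ioo τ₁ 0 → Φ τ₂ ≤ Φ τ₁ := by
    filter_upwards [ae_energy_le_add_flux le_rfl hsw hσ hσcs hσ0] with τ₁ hτ₁ hneg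
    filter_upwards [hτ₁ hneg] with τ₂ hτ₂ hI
    have key := hτ₂ hI
    have hflux : ∫ z in Ico τ₁ τ₂ ×ˢ (univ : Set (EuclideanSpace ℝ (Fin 3))),
        (‖u z.1 z.2‖ ^ 2 * (0 * Δ σ z.2) +
          (‖u z.1 z.2‖ ^ 2 + 2 * p z.1 z.2) * ⟪u z.1 z.2, gradient σ z.2⟫) ≤ 0 := by
      refine setIntegral_nonpos_ae (measurableSet_Ico.prod MeasurableSet.univ) ?_
      filter_upwards [hflux0] with z hz hzI
      exact hz ⟨hzI.1.2.trans hI.2, mem_univ _⟩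
    simp only [hΦ]
    linarith [key, hflux]
  -- (3) far-past smallness from stub 2 (backward vanishing on `B(0, 2r₀/3)`)
  have hsmall : ∀ ε : ℝ, 0 < ε → ∀ T : ℝ, ∃ᵐ τ ∂(volume : Measure ℝ), τ < -T ∧ Φ τ ≤ ε := by
    intro ε hε T
    set R : ℝ := 2 * (r₀ / 3) with hRdef
    have hR : 0 < R := by positivity
    have hvb := Backward.vanishesBackward_of_gauge hρ hH hA hE (R := R) (ε := ε) hR hε
    set Bad : ℝ → Set ℝ := fun a => {τ : ℝ | τ ∈ Ioo (-(a ^ 2)) 0 ∧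
      ENNReal.ofReal ε < ∫⁻ y in ball (0 : EuclideanSpace ℝ (Fin 3)) R, ‖u τ y‖ₑ ^ 2} with hBad
    -- a time outside `Bad a` has local energy `≤ ε`
    have hgood : ∀ (a τ : ℝ), τ ∈ Ioo (-(a ^ 2)) 0 → τ ∉ Bad a → Φ τ ≤ ε := by
      intro a τ hτ hnb
      have hle : ∫⁻ y in ball (0 : EuclideanSpace ℝ (Fin 3)) R, ‖u τ y‖ₑ ^ 2 ≤ ENNReal.ofReal ε := by
        by_contra hcon
        exact hnb ⟨hτ, not_le.1 hcon⟩
      have hnn0 : 0 ≤ᵐ[volume] fun x => ‖u τ x‖ ^ 2 * σ x :=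
        Eventually.of_forall fun x => mul_nonneg (sq_nonneg _) (hσ0 _)
      have h1 : ENNReal.ofReal (Φ τ) ≤ ∫⁻ x, ENNReal.ofReal (‖u τ x‖ ^ 2 * σ x) := by
        by_cases hint : Integrable (fun x => ‖u τ x‖ ^ 2 * σ x) volume
        · exact (ofReal_integral_eq_lintegral_ofReal hint hnn0).le
        · simp only [hΦ]
          rw [integral_undef hint, ENNReal.ofReal_zero]
          exact bot_le
      have h2 : ∫⁻ x, ENNReal.ofReal (‖u τ x‖ ^ 2 * σ x) ≤
          ∫⁻ y in ball (0 : EuclideanSpace ℝ (Fin 3)) R, ‖u τ y‖ₑ ^ 2 := by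
        rw [← lintegral_indicator measurableSet_ball]
        refine lintegral_mono fun x => ?_
        by_cases hx : x ∈ ball (0 : EuclideanSpace ℝ (Fin 3)) R
        · rw [indicator_of_mem hx, ← ofReal_norm, ← ENNReal.ofReal_pow (norm_nonneg _)]
          exact ENNReal.ofReal_le_ofReal (mul_le_of_le_one_right (sq_nonneg _) (hσle _))
        · rw [indicator_of_notMem hx]
          rw [mem_ball, dist_zero_right, not_lt] at hx
          rw [hσzero x hx, mul_zero, ENNReal.ofReal_zero]
      exact (ENNReal.ofReal_le_ofReal_iff hε.le).1 ((h1.trans h2).trans hle)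
    have hev1 : ∀ᶠ a : ℝ in atTop, volume (Bad a) / ENNReal.ofReal (a ^ 2) < 1 / 2 :=
      (tendsto_order.1 hvb).2 _ (by norm_num)
    have hev2 : ∀ᶠ a : ℝ in atTop, 2 * (|T| + 1) < a ^ 2 :=
      (tendsto_pow_atTop two_ne_zero).eventually_gt_atTop _
    obtain ⟨a, ha1, ha2⟩ := (hev1.and hev2).exists
    have ha2pos : 0 < a ^ 2 := by linarith [abs_nonneg T]
    have hBadlt : volume (Bad a) < ENNReal.ofReal (a ^ 2 / 2) := by
      have h := ha1
      rw [ENNReal.div_lt_iff (Or.inl (ENNReal.ofReal_pos.2 ha2pos).ne') (Or.inl ENNReal.ofReal_ne_top)]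
        at h
      calc volume (Bad a) < 1 / 2 * ENNReal.ofReal (a ^ 2) := h
        _ = ENNReal.ofReal (a ^ 2 / 2) := by
          rw [show a ^ 2 / 2 = (1 / 2) * a ^ 2 by ring, ENNReal.ofReal_mul (by norm_num),
            ENNReal.ofReal_div_of_pos two_pos, ENNReal.ofReal_one, ENNReal.ofReal_ofNat]
    by_contra hcon
    have hae : ∀ᵐ τ ∂(volume : Measure ℝ), τ ∈ Ioo (-(a ^ 2)) (-(a ^ 2) / 2) → τ ∈ Bad a := by
      have h := Filter.not_frequently.1 hcon
      filter_upwards [h] with τ hτ hW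
      by_contra hnb
      have hτ0 : τ ∈ Ioo (-(a ^ 2)) 0 := ⟨hW.1, by linarith [hW.2]⟩
      have hT : τ < -T := by
        have : T ≤ |T| := le_abs_self T
        linarith [hW.2]
      exact hτ ⟨hT, hgood a τ hτ0 hnb⟩
    have hWle : volume (Ioo (-(a ^ 2)) (-(a ^ 2) / 2)) ≤ volume (Bad a) :=
      measure_mono_ae (by filter_upwards [hae] with τ hτ; exact fun hW => hτ hW)
    rw [Real.volume_Ioo, show -(a ^ 2) / 2 - -(a ^ 2) = a ^ 2 / 2 by ring] at hWle
    exact absurd (hWle.trans_lt hBadlt) (lt_irrefl _)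
  -- (4) `Φ ≤ 1/(n+1)` a.e. on `(−(n+1), 0)`, hence `Φ = 0` a.e. on `(−∞, 0)`
  have hsmallae : ∀ n : ℕ, ∀ᵐ τ₂ : ℝ, τ₂ ∈ Ioo (-((n : ℝ) + 1)) 0 → Φ τ₂ ≤ 1 / ((n : ℝ) + 1) := by
    intro n
    have hε : (0 : ℝ) < 1 / ((n : ℝ) + 1) := by positivity
    obtain ⟨τ₁, ⟨hτ₁T, hΦτ₁⟩, hτ₁mono⟩ := ((hsmall _ hε (n + 1)).and_eventually hmono).exists
    have hτ₁0 : τ₁ < 0 := by linarith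
    filter_upwards [hτ₁mono hτ₁0] with τ₂ hτ₂ hmem
    exact (hτ₂ ⟨by linarith [hmem.1], hmem.2⟩).trans hΦτ₁
  have hzero : ∀ᵐ τ : ℝ, τ < 0 → Φ τ = 0 := by
    rw [← ae_all_iff] at hsmallae
    filter_upwards [hsmallae] with τ hτ hlt
    refine le_antisymm ?_ (hΦ0 τ)
    refine le_of_forall_pos_le_add fun δ hδ => ?_
    rw [zero_add]
    obtain ⟨n, hn⟩ := exists_nat_gt (max (1 / δ) (-τ))
    have hn1 : 1 / δ < (n : ℝ) + 1 := by linarith [le_max_left (1 / δ) (-τ)]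
    have hn2 : -τ < (n : ℝ) + 1 := by linarith [le_max_right (1 / δ) (-τ)]
    have hδ' : 1 / ((n : ℝ) + 1) ≤ δ := by
      rw [div_lt_iff₀ hδ] at hn1
      rw [div_le_iff₀ (by positivity)]
      linarith
    exact (hτ n ⟨by linarith, hlt⟩).trans hδ'
  -- (5) slice integrability: for a.e. `τ < 0`, `|u(τ)|²` is integrable on `B̄(0, r₀)`
  have hum : AEStronglyMeasurable (uncurry u)
      (volume.restrict (Iio (0 : ℝ) ×ˢ (univ : Set (EuclideanSpace ℝ (Fin 3))))) := by
    have := hH.locallyIntegrableOn.aestronglyMeasurable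
    simpa [slab] using this
  have hL2 : LocallyIntegrableOn (fun z : ℝ × EuclideanSpace ℝ (Fin 3) => ‖uncurry u z‖ ^ 2)
      (Iio (0 : ℝ) ×ˢ (univ : Set (EuclideanSpace ℝ (Fin 3)))) volume := by
    have := hsw.distributional.2.1
    simpa [slab] using this
  have hsliceInt : ∀ n : ℕ, ∀ᵐ τ : ℝ, τ ∈ Icc (-((n : ℝ) + 1)) (-(1 / ((n : ℝ) + 1))) →
      IntegrableOn (fun x => ‖u τ x‖ ^ 2) (closedBall (0 : EuclideanSpace ℝ (Fin 3)) r₀) volume := by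
    intro n
    have hKc : IsCompact (Icc (-((n : ℝ) + 1)) (-(1 / ((n : ℝ) + 1))) ×ˢ
        closedBall (0 : EuclideanSpace ℝ (Fin 3)) r₀) := isCompact_Icc.prod (isCompact_closedBall _ _)
    have hKS : Icc (-((n : ℝ) + 1)) (-(1 / ((n : ℝ) + 1))) ×ˢ closedBall (0 : EuclideanSpace ℝ (Fin 3)) r₀ ⊆
        Iio (0 : ℝ) ×ˢ (univ : Set (EuclideanSpace ℝ (Fin 3))) := by
      rintro ⟨t, x⟩ ⟨ht, -⟩
      refine ⟨?_, mem_univ _⟩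
      have : (0 : ℝ) < 1 / ((n : ℝ) + 1) := by positivity
      exact lt_of_le_of_lt ht.2 (by linarith)
    have hIK : IntegrableOn (fun z : ℝ × EuclideanSpace ℝ (Fin 3) => ‖uncurry u z‖ ^ 2)
        (Icc (-((n : ℝ) + 1)) (-(1 / ((n : ℝ) + 1))) ×ˢ closedBall (0 : EuclideanSpace ℝ (Fin 3)) r₀)
        volume :=
      hL2.integrableOn_compact_subset hKS hKc
    rw [IntegrableOn, Measure.volume_eq_prod, ← Measure.prod_restrict] at hIK
    have h := hIK.prod_right_ae
    rw [ae_restrict_iff' measurableSet_Icc] at h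
    filter_upwards [h] with τ hτ hmem
    exact hτ hmem
  have hslice : ∀ᵐ τ : ℝ, τ < 0 →
      IntegrableOn (fun x => ‖u τ x‖ ^ 2) (closedBall (0 : EuclideanSpace ℝ (Fin 3)) r₀) volume := by
    rw [← ae_all_iff] at hsliceInt
    filter_upwards [hsliceInt] with τ hτ hlt
    obtain ⟨n, hn⟩ := exists_nat_gt (max (-τ) (1 / (-τ)))
    have hn1 : -τ < (n : ℝ) + 1 := by linarith [le_max_left (-τ) (1 / (-τ))]
    have hn2 : 1 / (-τ) < (n : ℝ) + 1 := by linarith [le_max_right (-τ) (1 / (-τ))]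
    refine hτ n ⟨by linarith, ?_⟩
    have hτpos : 0 < -τ := neg_pos.2 hlt
    rw [div_lt_iff₀ hτpos] at hn2
    have : 1 / ((n : ℝ) + 1) < -τ := by
      rw [div_lt_iff₀ (by positivity)]
      linarith
    linarith
  -- (6) at a.e. `τ < 0`: `u(τ) = 0` a.e. on `B_{r₀/3}`
  have hslice0 : ∀ᵐ τ : ℝ, τ < 0 →
      ∀ᵐ x ∂(volume : Measure (EuclideanSpace ℝ (Fin 3))), ‖x‖ < r₀ / 3 → u τ x = 0 := by
    filter_upwards [hzero, hslice] with τ hτ0 hτI hlt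
    have hΦτ := hτ0 hlt
    have hI := hτI hlt
    -- integrability of `|u τ|² σ` on `ℝ³` (support in `B̄(0, r₀)`)
    have hmeas : AEStronglyMeasurable (fun x => ‖u τ x‖ ^ 2 * σ x)
        (volume.restrict (closedBall (0 : EuclideanSpace ℝ (Fin 3)) r₀)) :=
      hI.aestronglyMeasurable.mul hσ.continuous.aestronglyMeasurable
    have hK : IntegrableOn (fun x => ‖u τ x‖ ^ 2 * σ x)
        (closedBall (0 : EuclideanSpace ℝ (Fin 3)) r₀) volume := by
      refine Integrable.mono' hI hmeas (Eventually.of_forall fun x => ?_)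
      rw [Real.norm_eq_abs, abs_mul, abs_of_nonneg (sq_nonneg _), abs_of_nonneg (hσ0 _)]
      exact mul_le_of_le_one_right (sq_nonneg _) (hσle _)
    have hoff : ∀ x : EuclideanSpace ℝ (Fin 3), x ∉ closedBall (0 : EuclideanSpace ℝ (Fin 3)) r₀ →
        ‖u τ x‖ ^ 2 * σ x = 0 := by
      intro x hx
      rw [mem_closedBall, dist_zero_right, not_le] at hx
      rw [hσzero x (by linarith), mul_zero]
    have hint : Integrable (fun x => ‖u τ x‖ ^ 2 * σ x) volume := by
      have hU := hK.of_forall_sdiff_eq_zero MeasurableSet.univ fun x hx => hoff x hx.2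
      rwa [integrableOn_univ] at hU
    have hnn : 0 ≤ᵐ[volume] fun x => ‖u τ x‖ ^ 2 * σ x :=
      Eventually.of_forall fun x => mul_nonneg (sq_nonneg _) (hσ0 _)
    have hae := (integral_eq_zero_iff_of_nonneg_ae hnn hint).1 hΦτ
    filter_upwards [hae] with x hx hxr
    have hσx : σ x = 1 := hσ1 x hxr.le
    have h0 : ‖u τ x‖ ^ 2 = 0 := by simpa [hσx] using hx
    exact norm_eq_zero.1 (pow_eq_zero_iff two_ne_zero |>.1 h0)
  -- (7) assemble the statement on the product space (via a strongly measurable modification)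
  rw [Measure.volume_eq_prod, ← Measure.prod_restrict, Measure.restrict_univ] at hum ⊢
  set ut := hum.mk (uncurry u) with hut
  have hT : MeasurableSet ({z : ℝ × EuclideanSpace ℝ (Fin 3) | r₀ / 3 ≤ ‖z.2‖} ∪
      {z : ℝ × EuclideanSpace ℝ (Fin 3) | ut z = 0}) :=
    (measurableSet_le measurable_const measurable_snd.norm).union
      (hum.stronglyMeasurable_mk.measurableSet_eq_fun stronglyMeasurable_const)
  have hae := hum.ae_eq_mk
  have h1 := Measure.ae_ae_of_ae_prod hae
  have h2 : ∀ᵐ τ ∂((volume : Measure ℝ).restrict (Iio (0 : ℝ))), τ < 0 :=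
    ae_restrict_mem measurableSet_Iio
  have h3 : ∀ᵐ τ ∂((volume : Measure ℝ).restrict (Iio (0 : ℝ))),
      ∀ᵐ x ∂(volume : Measure (EuclideanSpace ℝ (Fin 3))),
        (τ, x) ∈ ({z : ℝ × EuclideanSpace ℝ (Fin 3) | r₀ / 3 ≤ ‖z.2‖} ∪
          {z : ℝ × EuclideanSpace ℝ (Fin 3) | ut z = 0}) := by
    filter_upwards [h1, h2, ae_restrict_of_ae hslice0] with τ hτ hτ0 hτs
    filter_upwards [hτ, hτs hτ0] with x hx hx0
    by_cases hxr : ‖x‖ < r₀ / 3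
    · right
      show ut (τ, x) = 0
      rw [hut, ← hx]
      exact hx0 hxr
    · left
      exact not_lt.1 hxr
  have h4 := (Measure.ae_prod_mem_iff_ae_ae_mem hT).2 h3
  filter_upwards [h4, hae] with z hz hzu hzr
  rcases hz with h | h
  · exact absurd hzr (not_lt.2 h)
  · rw [hut] at h
    exact (show uncurry u z = 0 by rw [hzu]; exact h)

/-- **No Euler collapse with outward Bernoulli flux (every `ρ > 0`) — the crux VERBATIM plus one
hypothesis.**  Under the hypotheses of `EulerZoomLiouville.PowerGaugeEulerLiouville` at exponent
`ρ > 0`, a member whose Bernoulli flux is OUTWARD a.e. on the slab, `0 ≤ (|u|² + 2p) ⟪u, x⟫` for a.e.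
`(τ, x) ∈ (−∞,0) × ℝ³`, vanishes a.e. on the slab.  Contrapositive: every nontrivial member — in
particular every in-window self-similar / DSS collapse candidate of the open core — transports Bernoulli
energy INWARD on a positive-measure subset of `(−∞,0) × B_r` for every `r > 0`. [folklore] -/
theorem powerGaugeEulerLiouville_of_outgoingFlux (hρ : 0 < ρ)
    (hsw : IsSuitableWeakSolutionOn (slab (EuclideanSpace ℝ (Fin 3)) (Iio 0) isOpen_Iio) 0 0 u p)
    (hH : HasWeakSpatialGradientOn (slab (EuclideanSpace ℝ (Fin 3)) (Iio 0) isOpen_Iio) u H)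
    (hgauge : ∀ a : ℝ, 0 < a →
      ENNReal.ofReal (a ^ (2 * ρ)) * cknA a (0 : ℝ × EuclideanSpace ℝ (Fin 3)) u +
          ENNReal.ofReal (a ^ ρ) * cknE a (0 : ℝ × EuclideanSpace ℝ (Fin 3)) H +
        ENNReal.ofReal (a ^ (2 * ρ)) * cknD a (0 : ℝ × EuclideanSpace ℝ (Fin 3)) p ≤ (c : ℝ≥0∞))
    (hout : ∀ᵐ z ∂(volume.restrict (Iio (0 : ℝ) ×ˢ (univ : Set (EuclideanSpace ℝ (Fin 3))))),
      0 ≤ (‖u z.1 z.2‖ ^ 2 + 2 * p z.1 z.2) * ⟪u z.1 z.2, z.2⟫) :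
    uncurry u =ᵐ[volume.restrict (Iio (0 : ℝ) ×ˢ (univ : Set (EuclideanSpace ℝ (Fin 3))))] 0 := by
  have hn : ∀ n : ℕ, ∀ᵐ z ∂(volume.restrict (Iio (0 : ℝ) ×ˢ (univ : Set (EuclideanSpace ℝ (Fin 3))))),
      ‖z.2‖ < (n : ℝ) + 1 → u z.1 z.2 = 0 := by
    intro n
    have h := ae_eq_zero_near_origin_of_outgoingFlux hρ hsw hH hgauge (r₀ := 3 * ((n : ℝ) + 1))
      (by positivity) (hout.mono fun z hz _ => hz)
    filter_upwards [h] with z hz hzn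
    exact hz (by linarith)
  rw [← ae_all_iff] at hn
  filter_upwards [hn] with z hz
  obtain ⟨n, hn'⟩ := exists_nat_gt ‖z.2‖
  exact hz n (by linarith)

end Member

end Summit.NavierStokesRegularity.NavierStokesRegularity.Theorems.PowerGaugeEulerLiouville

end
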